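import Mathlib
import Summits.Ventures.PercRepro2.Defs
import Summits.Ventures.PercRepro2.Independence
import Summits.Ventures.PercRepro2.Harris
import Summits.Ventures.PercRepro2.Graph
import Summits.Ventures.PercRepro2.Events
import Summits.Ventures.PercRepro2.PartitionThree
import Summits.Ventures.PercRepro2.ZCTwoEdge
import Summits.Ventures.PercRepro2.ZCLeafReductions
import Summits.Ventures.PercRepro2.ZCLeafReductionsGraph
import Summits.Ventures.PercRepro2.ZCLeafRoot

/-!
# The root-leaf reduction of (ZC) on the graph: a pendant root reduces (ZC) to `G − a₁`
(blind cell PercRepro2, mine-a g23; MINE-A.md §70.5, (L₁))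

The graph instance of `zc_leaf_root`.  The root `a₁` is a leaf at `z` through `f`
(`hleaf : ∀ e, a₁ ∈ ends e → e = f`), `𝓔` is an up-set with `{a₁} ∉ 𝓔`, `p' = p[f ↦ 0]`
(percolation on `G − a₁`) and `𝓔' = {S ∣ insert a₁ S ∈ 𝓔}`.  Then
  `(ZC)_{p'}(z, a₃, o; 𝓔') ≥ 0  →  (ZC)_p(a₁, a₃, o; 𝓔) ≥ p f · (ZC)_{p'}(z, a₃, o; 𝓔')`
(`zc_leaf_root_graph`).  The structural facts: `C(a₁) = insert a₁ C⁻(z)` if `f` is open and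
`{a₁}` if it is closed (`cluster_leaf_eq`, `cluster_leaf_closed`), `{a₁ ↔ x} = {f open} ∩ {z ↔ x in ω⁻}`
(`conn_leaf_iff`), `{a₃ ↔ o} = {a₃ ↔ o in ω⁻}` (`conn_leaf_iff_of_ne`); the (P1) input is the
cell's `partitionThree_lattice` on `G − a₁`.  With (L0), (L_o), (L₃) the (ZC) class is closed under
attaching any leaf; by induction on the number of vertices this gives (ZC) on every finite tree
(MINE-A.md §70.5, paper).  One seat.
-/

namespace Summit.Ventures.PercRepro2

section LeafClosed

variable {V : Type*} {E : Type*} [DecidableEq E] {ends : E → Sym2 V} {ℓ : V} {f : E}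

omit [DecidableEq E] in
/-- A leaf whose edge is closed is its own cluster. -/
lemma cluster_leaf_closed (hleaf : ∀ e, ℓ ∈ ends e → e = f) {ω : Config E} (hf : ω f = false) :
    cluster ends ω ℓ = {ℓ} := by
  apply Set.Subset.antisymm
  · intro u hu
    refine mem_of_conn_of_closed (S := {ℓ}) ?_ rfl hu
    intro v hv y hvy
    rw [openGraph_adj] at hvy
    obtain ⟨_, e, he, hends⟩ := hvy
    have hv' : v = ℓ := hv
    subst hv'
    have hl : v ∈ ends e := by rw [hends]; exact Sym2.mem_mk_left _ _
    have := hleaf e hl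
    subst this
    rw [hf] at he
    exact absurd he Bool.false_ne_true
  · intro u hu
    have hu' : u = ℓ := hu
    subst hu'; exact mem_cluster_self _ _ _

end LeafClosed

section LeafRootGraph

variable {V : Type*} {E : Type*} [Fintype E] [DecidableEq E] {R : Type*} [CommRing R]
  [LinearOrder R] [IsStrictOrderedRing R]

/-- **(L₁) on the graph.**  `a₁` a leaf at `z` through `f`; `𝓔` an up-set with `{a₁} ∉ 𝓔`;
`p' = p[f ↦ 0]`, `𝓔' = {S ∣ insert a₁ S ∈ 𝓔}`.  If the (ZC) expression of `G − a₁` for the marks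
`(z, a₃, o)` and `𝓔'` is nonnegative, then
  `(ZC)_p(a₁, a₃, o; 𝓔) ≥ p f · (ZC)_{p'}(z, a₃, o; 𝓔')`. -/
theorem zc_leaf_root_graph {p : E → R} (hp : IsProbVec p) {ends : E → Sym2 V} {a₁ a₃ o z : V}
    {f : E} (hends : ends f = s(z, a₁)) (hleaf : ∀ e, a₁ ∈ ends e → e = f) (h13 : a₁ ≠ a₃)
    (h1o : a₁ ≠ o) (h1z : a₁ ≠ z) {𝓔 : Set (Set V)} (h𝓔 : IsUpperSet 𝓔)
    (h𝓔₁ : ({a₁} : Set V) ∉ 𝓔)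
    (hZ : let p' := Function.update p f 0
      let 𝓔' : Set (Set V) := {S | insert a₁ S ∈ 𝓔}
      let e' := connEvent ends z a₃
      let L' := connEvent ends z o
      let U' := clusterInEvent ends z 𝓔'
      let γ' := connEvent ends a₃ o
      0 ≤ prob p' (e'ᶜ ∩ L'ᶜ ∩ γ'ᶜ) * (prob p' (U' ∩ (e' ∩ L')) - prob p' U' * prob p' (e' ∩ L'))
        - prob p' (e'ᶜ ∩ L'ᶜ ∩ γ') * (prob p' (U' ∩ (e' ∩ L'ᶜ)) - prob p' U' * prob p' (e' ∩ L'ᶜ))) :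
    let e := connEvent ends a₁ a₃
    let L := connEvent ends a₁ o
    let U := clusterInEvent ends a₁ 𝓔
    let γ := connEvent ends a₃ o
    let p' := Function.update p f 0
    let 𝓔' : Set (Set V) := {S | insert a₁ S ∈ 𝓔}
    let e' := connEvent ends z a₃
    let L' := connEvent ends z o
    let U' := clusterInEvent ends z 𝓔'
    let γ' := connEvent ends a₃ o
    prob p (eᶜ ∩ Lᶜ ∩ γᶜ) * (prob p (U ∩ (e ∩ L)) - prob p U * prob p (e ∩ L))
      - prob p (eᶜ ∩ Lᶜ ∩ γ) * (prob p (U ∩ (e ∩ Lᶜ)) - prob p U * prob p (e ∩ Lᶜ))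
      ≥ p f * (prob p' (e'ᶜ ∩ L'ᶜ ∩ γ'ᶜ) * (prob p' (U' ∩ (e' ∩ L')) - prob p' U' * prob p' (e' ∩ L'))
          - prob p' (e'ᶜ ∩ L'ᶜ ∩ γ') * (prob p' (U' ∩ (e' ∩ L'ᶜ)) - prob p' U' * prob p' (e' ∩ L'ᶜ))) := by
  intro e L U γ p' 𝓔' e' L' U' γ'
  simp only at hZ
  have hz1 : z ≠ a₁ := Ne.symm h1z
  -- the `ω⁻`-events
  set Ez : Set (Config E) := {ω | Function.update ω f false ∈ e'} with hEz
  set Lz : Set (Config E) := {ω | Function.update ω f false ∈ L'} with hLz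
  set γz : Set (Config E) := {ω | Function.update ω f false ∈ γ'} with hγz
  set X' : Set (Config E) := {ω | Function.update ω f false ∈ U'} with hX'
  -- the graph events in the abstract form
  have he : e = openEdge f ∩ Ez := by
    ext ω
    simp only [e, Ez, e', Set.mem_inter_iff, Set.mem_setOf_eq, mem_connEvent, mem_openEdge]
    constructor
    · intro h
      obtain ⟨hf, hc⟩ := (conn_leaf_iff hends hleaf hz1 ω (Ne.symm h13)).1 (conn_symm h)
      exact ⟨hf, conn_symm hc⟩
    · rintro ⟨hf, hc⟩
      exact conn_symm ((conn_leaf_iff hends hleaf hz1 ω (Ne.symm h13)).2 ⟨hf, conn_symm hc⟩)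
  have hL : L = openEdge f ∩ Lz := by
    ext ω
    simp only [L, Lz, L', Set.mem_inter_iff, Set.mem_setOf_eq, mem_connEvent, mem_openEdge]
    constructor
    · intro h
      obtain ⟨hf, hc⟩ := (conn_leaf_iff hends hleaf hz1 ω (Ne.symm h1o)).1 (conn_symm h)
      exact ⟨hf, conn_symm hc⟩
    · rintro ⟨hf, hc⟩
      exact conn_symm ((conn_leaf_iff hends hleaf hz1 ω (Ne.symm h1o)).2 ⟨hf, conn_symm hc⟩)
  have hγ : γ = γz := by
    ext ω
    simp only [γ, γz, γ', Set.mem_setOf_eq, mem_connEvent]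
    exact conn_leaf_iff_of_ne hends hleaf hz1 ω (Ne.symm h13) (Ne.symm h1o)
  have hU : U = openEdge f ∩ X' := by
    ext ω
    simp only [U, X', U', 𝓔', Set.mem_inter_iff, Set.mem_setOf_eq, mem_clusterInEvent,
      mem_openEdge]
    rcases Bool.eq_false_or_eq_true (ω f) with hf | hf
    · have hconn : Conn ends ω a₁ z := conn_symm (conn_of_openAdj ⟨f, hf, hends⟩)
      rw [cluster_eq_of_conn hconn, cluster_leaf_eq hends hleaf hz1 ω (Ne.symm h1z)]
      have hset : cluster ends (Function.update ω f false) z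
          ∪ {u | u = a₁ ∧ ω f = true ∧ z ∈ cluster ends (Function.update ω f false) z}
          = insert a₁ (cluster ends (Function.update ω f false) z) := by
        ext u; simp [hf, conn_refl]
      rw [hset]; simp [hf]
    · rw [cluster_leaf_closed hleaf hf]; simp [hf, h𝓔₁]
  -- invariance under forcing `f`
  have inv : ∀ (A : Set (Config E)) (ω : Config E) (b : Bool),
      Function.update ω f b ∈ {ω | Function.update ω f false ∈ A} ↔
        ω ∈ {ω | Function.update ω f false ∈ A} := by
    intro A ω b; simp only [Set.mem_setOf_eq, closeOne_update]
  -- monotonicity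
  have hEzup : IsUpperSet Ez := fun ω ω' hle hω => conn_mono (closeOne_mono f hle) hω
  have hLzup : IsUpperSet Lz := fun ω ω' hle hω => conn_mono (closeOne_mono f hle) hω
  have hγzup : IsUpperSet γz := fun ω ω' hle hω => conn_mono (closeOne_mono f hle) hω
  have h𝓔'up : IsUpperSet 𝓔' := fun S S' hSS' hS => h𝓔 (Set.insert_subset_insert hSS') hS
  have hX'up : IsUpperSet X' := fun ω ω' hle hω =>
    h𝓔'up (cluster_mono (closeOne_mono f hle) z) hω
  -- `γz = (Ez ∩ Lz) ∪ (Ezᶜ ∩ Lzᶜ ∩ γz)`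
  have hγeq : γz = (Ez ∩ Lz) ∪ (Ezᶜ ∩ Lzᶜ ∩ γz) := by
    ext ω
    simp only [Ez, Lz, γz, e', L', γ', Set.mem_union, Set.mem_inter_iff, Set.mem_compl_iff,
      Set.mem_setOf_eq, mem_connEvent]
    constructor
    · intro h
      by_cases hz3 : Conn ends (Function.update ω f false) z a₃
      · exact Or.inl ⟨hz3, conn_trans hz3 h⟩
      · exact Or.inr ⟨⟨hz3, fun hzo => hz3 (conn_trans hzo (conn_symm h))⟩, h⟩
    · rintro (⟨h1, h2⟩ | ⟨_, h⟩)
      · exact conn_trans (conn_symm h1) h2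
      · exact h
  -- (P1) on `G − a₁` for the marks `(z, a₃, o)`
  have hp' : IsProbVec p' := hp.update f le_rfl zero_le_one
  have hP1 : prob p (Ezᶜ ∩ Lzᶜ ∩ γz) * prob p (Ez ∩ Lzᶜ)
      ≤ prob p (Ezᶜ ∩ Lzᶜ ∩ γzᶜ) * prob p (Ez ∩ Lz) := by
    have h := partitionThree_lattice hp' ends z a₃ o
    rw [partBCa_eq_three, partAll_eq_ab_ac] at h
    simp only [partABc, partApart, p', prob_update_zero_eq_shift, closeOne_setOf_inter,
      closeOne_setOf_compl] at h
    simp only [hEz, hLz, hγz, e', L', γ']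
    linarith [h]
  -- the hypothesis `Z⁻ ≥ 0` as `ω⁻`-events
  have hZ' : 0 ≤ prob p (Ezᶜ ∩ Lzᶜ ∩ γzᶜ) * (prob p (X' ∩ (Ez ∩ Lz)) - prob p X' * prob p (Ez ∩ Lz))
      - prob p (Ezᶜ ∩ Lzᶜ ∩ γz) * (prob p (X' ∩ (Ez ∩ Lzᶜ)) - prob p X' * prob p (Ez ∩ Lzᶜ)) := by
    simp only [prob_update_zero_eq_shift, closeOne_setOf_inter, closeOne_setOf_compl] at hZ
    simp only [hEz, hLz, hγz, hX']
    exact hZ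
  have key := zc_leaf_root hp f (inv e') (inv L') (inv γ') (inv U') hEzup hLzup hγzup hX'up hγeq
    hP1 hZ'
  simp only at key
  rw [he, hL, hU, hγ]
  simp only [hEz, hLz, hγz, hX'] at key ⊢
  simp only [p', prob_update_zero_eq_shift, closeOne_setOf_inter, closeOne_setOf_compl]
  exact key

end LeafRootGraph

end Summit.Ventures.PercRepro2
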